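import Summits.QuantumFields.YangMills.Theorems.BalabanUVNodesN15KingModelThm33AtRegularFieldIntervalBox
import Summits.QuantumFields.YangMills.Theorems.BalabanUVNodesN15KingModelRegularFieldWindow

/-!
# Route «BalabanUVNodes», node N15 = NE2 — THE KING-MODEL RUNG, g21 PACKAGE: KING 1986 THEOREM 3.3 (and [B9] THEOREM 3.15) BY NAME **AT A REGULAR
# BACKGROUND A ≠ 0** — «what the curved case adds» to the A = 0 rung (FAN-OUT v1.1 §N15 row s3), ONE NAME over the five g21 results

Cell `pub-ymgap`, Track A (D-0062), seat `pub-ymgap-dag-n15-e` (R141 (C), s3), generation 21.  `bears_on: R4∕N15`; `--supports stmt-QuantumFields-27366`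
(K3⁸, `--as helper`).  COUNT-NEUTRAL.  Namespace `…N15KingModelRung.Curved`.

WHAT THIS FILE PROVES (0 `sorry`, no `def`).  ★★★ `king_thm33_regularField_package` — the conjunction, BY NAME, of
(1) PART Θ⁺ `thm33Printed_king_regularField`: `ContinuumLimit.Thm33Printed (kingThm33DataReg C P k A a m²)` on the whole torus `Ω = T_ε` for every field
    `A` of the regular window `|ΔA| ≤ δ`, `L^k·δ·|e| ≤ t(K₀)` (the `δ`-operators vanish there);
(2) PART Θ⁺⁺-d `thm33Printed_king_regularField_region`: the same on every big-block REGION `Ω ⊊ T_ε` with the `δ`-clauses LIVE, observation points and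
    sources on the `R₀`-interior ([Ba1] Prop. 2.1's printed restriction);
(3) PART Θ⁺⁺⁺-d `thm33Printed_king_regularField_intervalBox`: the same on every big-block INTERVAL BOX (King's «rectangular parallelepiped which is a
    union of large blocks») with sides at most half the torus, `δ`-clauses LIVE, NO `R₀`-restriction, transports along the coordinate staircases;
(4) PART Θ⁺-b `thm315Printed_higgs_regularField`: [B9] Theorem 3.15 `Thm315Printed` for the (Higgs)₂,₃ unit-lattice covariances at LIVE backgrounds;
(5) PART Θ⁺-c `exists_curved_in_window`: the regular window contains fields with non-zero plaquette field strength (the curved case is not empty).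
[cite: King1986, Def. 3.2, Thm 3.3 (3.6)–(3.8) pp.655–656] [cite: Balaban1982Higgs1, Props. 2.1–2.3 pp.610–612] [cite: Balaban1985BackgroundPropagators, Thm 3.15]

HONEST FRAMING ∕ SCOPE.  A conjunction of landed theorems, nothing new; every conjunct keeps its own hypotheses and scope (cubic tori of r14's sub-family,
constants per cube size `K₀`, `m² > 0`, `1 ≤ k < K_P`, `L^kε ≤ 1`, regularity on all of `T_ε`; (2) `R₀`-interior carrier and `L ∣ K₀`; (3) bond-closed
carrier `bset Ω`, sides ≤ half the torus; (5) `d ≥ 2`).  This is the KING-MODEL (abelian Higgs) currency of NE2's covariance∕background layer at a curved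
background; NOT Bałaban's non-abelian `G(U)`; NE2⁺ NOT printed ∕ not proved; NOT a node discharge; counts untouched; nothing continuum ∕ ℝ⁴ ∕ OS ∕ mass-gap ∕ Clay.
-/

noncomputable section

namespace Summit.QuantumFields.YangMills.BalabanUVNodes.N15KingModelRung.Curved

open Literature.MathematicalPhysics.QuantumFieldTheory.Balaban1983to89
open Literature.MathematicalPhysics.QuantumFieldTheory.Balaban1983to89.HiggsLattice (ChargeData)
open Literature.MathematicalPhysics.QuantumFieldTheory.Balaban1983to89.B1Eq211ZeroFieldTorus (Shape)
open Literature.MathematicalPhysics.QuantumFieldTheory.Balaban1983to89.B1TorusCubeCover (half)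
open Literature.MathematicalPhysics.QuantumFieldTheory.Balaban1983to89.B1TorusRegionHSizes (IsBigBlockUnion)
open Literature.MathematicalPhysics.QuantumFieldTheory.Balaban1983to89.B1Ineq225RegularBox (cellBox)
open Literature.MathematicalPhysics.QuantumFieldTheory.King1986.ContinuumLimit (Thm33Printed)

variable {N : ℕ}

/-- ★★★ **THE g21 PACKAGE — KING 1986 THEOREM 3.3 AND [B9] THEOREM 3.15 BY NAME AT A REGULAR BACKGROUND `A ≠ 0` IN THE KING MODEL**: torus ∧ big-block
regions (`δ` live, `R₀`-interior) ∧ big-block interval boxes (`δ` live, no `R₀`) ∧ [B9] Thm 3.15 at live backgrounds ∧ the window is not flat (module docstring).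
[cite: King1986, Thm 3.3 (3.6)–(3.8) pp.655–656] [cite: Balaban1982Higgs1, Props. 2.1–2.3 pp.610–612] [cite: Balaban1985BackgroundPropagators, Thm 3.15] -/
theorem king_thm33_regularField_package (d L : ℕ) (hd : 1 ≤ d) (hL : Odd L ∧ 1 < L) {a msq : ℝ} (ha : 0 < a) (hmsq : 0 < msq)
    (N : ℕ) (C : ChargeData N) :
    -- (1) Ω = T_ε (PART Θ⁺)
    (∃ K₀min : ℕ, ∃ t : ℕ → ℝ, (∀ K₀, 0 < t K₀) ∧ ∀ K₀ : ℕ, K₀min ≤ K₀ →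
      ∀ (P : HiggsLattice.Params) (_S : Shape P), P.d = d → P.L = L → K₀ ∣ P.M → 3 * K₀ ≤ 2 * P.M →
      ∀ {k : ℕ}, 1 ≤ k → k < P.K → P.mesh k ≤ 1 →
      ∀ (A : HiggsLattice.VecField P 0) {δ : ℝ}, 0 ≤ δ →
        (∀ (z : HiggsLattice.Site P 0) (μ ν : Fin P.d), |A ⟨z.shift ν, μ⟩ - A ⟨z, μ⟩| ≤ δ) →
        (P.L : ℝ) ^ k * δ * |C.e| ≤ t K₀ →
        Thm33Printed (kingThm33DataReg C P k A a msq)) ∧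
    -- (2) big-block regions, `δ`-clauses live, `R₀`-interior (PART Θ⁺⁺)
    (∃ K₀min : ℕ, ∀ K₀ : ℕ, K₀min ≤ K₀ → L ∣ K₀ → ∃ t : ℝ, 0 < t ∧
      ∀ (P : HiggsLattice.Params) (_S : Shape P), P.d = d → P.L = L → K₀ ∣ P.M → 3 * K₀ ≤ 2 * P.M →
      ∀ {k : ℕ}, 1 ≤ k → k < P.K → P.mesh k ≤ 1 →
      ∀ (Ω : Finset (HiggsLattice.Site P 0)), IsBigBlockUnion k K₀ Ω →
      ∀ (A : HiggsLattice.VecField P 0) {δ : ℝ}, 0 ≤ δ →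
        (∀ (z : HiggsLattice.Site P 0) (μ ν : Fin P.d), |A ⟨z.shift ν, μ⟩ - A ⟨z, μ⟩| ≤ δ) →
        (P.L : ℝ) ^ k * δ * |C.e| ≤ t →
        Thm33Printed (kingThm33DataOn C P k Ω (intSet k K₀ Ω) A a msq)) ∧
    -- (3) big-block interval boxes, `δ`-clauses live, no `R₀` (PART Θ⁺⁺⁺)
    (∃ K₀min : ℕ, ∀ K₀ : ℕ, K₀min ≤ K₀ → L ∣ K₀ → ∃ t : ℝ, 0 < t ∧
      ∀ (P : HiggsLattice.Params) (_S : Shape P), P.d = d → P.L = L → K₀ ∣ P.M → 3 * K₀ ≤ 2 * P.M →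
      ∀ {k : ℕ}, 1 ≤ k → k < P.K → P.mesh k ≤ 1 →
      ∀ (lo hi : Fin P.d → ℕ), (∀ μ, 2 * ((hi μ - lo μ) * half P k K₀) ≤ P.sitesPerDir 0 μ) →
      ∀ (A : HiggsLattice.VecField P 0) {δ : ℝ}, 0 ≤ δ →
        (∀ (z : HiggsLattice.Site P 0) (μ ν : Fin P.d), |A ⟨z.shift ν, μ⟩ - A ⟨z, μ⟩| ≤ δ) →
        (P.L : ℝ) ^ k * δ * |C.e| ≤ t →
        Thm33Printed (kingThm33DataAlong C P k (cellBox k K₀ (fun μ => Finset.Ico (lo μ) (hi μ)))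
          (bset (cellBox k K₀ (fun μ => Finset.Ico (lo μ) (hi μ)))) (fun y x => legsK y x) A a msq)) ∧
    -- (4) [B9] Theorem 3.15 at live backgrounds (PART Θ⁺-b)
    (∃ K₀ : ℕ, (∃ r : ℕ, K₀ = L ^ r) ∧ ∀ c35 : ℝ, 0 < c35 →
      B9.Thm315Printed c35 (fun i : HiggsCovIdx d L K₀ => higgsGeo (N := N) i) (fun i => higgsBg C i)
        (fun i => higgsCk C a msq i) (fun i y => y ∈ i.Λ) (fun _ y y' => (HiggsLattice.Site.tdist y y' : ℝ))) ∧
    -- (5) the regular window is not flat (PART Θ⁺-c)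
    (∀ (P : HiggsLattice.Params), 2 ≤ P.d → ∀ (k : ℕ) {t : ℝ}, 0 < t →
      ∃ (A : HiggsLattice.VecField P 0) (δ : ℝ), 0 ≤ δ ∧
        (∀ (z : HiggsLattice.Site P 0) (μ ν : Fin P.d), |A ⟨z.shift ν, μ⟩ - A ⟨z, μ⟩| ≤ δ) ∧
        (P.L : ℝ) ^ k * δ * |C.e| ≤ t ∧
        ∃ (x : HiggsLattice.Site P 0) (μ ν : Fin P.d), A ⟨x.shift μ, ν⟩ - A ⟨x, ν⟩ - (A ⟨x.shift ν, μ⟩ - A ⟨x, μ⟩) ≠ 0) :=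
  ⟨thm33Printed_king_regularField d L hL ha hmsq N C, thm33Printed_king_regularField_region d L hd hL ha hmsq N C,
    thm33Printed_king_regularField_intervalBox d L hd hL ha hmsq N C, thm315Printed_higgs_regularField d L hL ha hmsq N C,
    fun _ hd2 k _ ht => exists_curved_in_window C hd2 k ht⟩

end Summit.QuantumFields.YangMills.BalabanUVNodes.N15KingModelRung.Curved

end
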